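import Mathlib

/-!
# Tier4/Common/FundamentalDomainExists — a strict measurable fundamental domain from a countable cover by small
sets, for a free action of a countable group; for a discrete subgroup acting by left multiplication on a
second-countable Hausdorff topological group, such covers exist (the construction (M2) of S12378 / S12456)

Blind re-derivation cell `pub-hodge-repro`, Tier 4 (README §9–§10), seat t4-typer-2 (gen 0).  Target tree path
`lean/Summits/Ventures/HodgeRepro/Tier4/Common/FundamentalDomainExists.lean`.  Mathlib only.

THE CONSTRUCTION.  `Γ` a countable group acting on `X`, `V : ℕ → Set X` a cover by SMALL sets (`γ • V n` and `V n`
are disjoint for `γ ≠ 1`).  Put `D := ⋃ n, (V n ∖ ⋃ m < n, ⋃ γ, γ • V m)`.  Every orbit meets `D` in exactly one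
point: take the least `n` with `Γ x ∩ V n ≠ ∅` (`exists_unique_smul_mem_domainOfCover`); `D` is measurable when
the `V n` are and the action is by measurable maps; so `D` is a fundamental domain in Mathlib's sense
(`IsFundamentalDomain.mk'`: `isFundamentalDomain_domainOfCover`).  If moreover finitely many `V n` already meet
every orbit (`∀ x, ∃ n ≤ N, ∃ γ, γ • x ∈ V n` — cocompactness, once the `V n` are relatively compact), then
`D ⊆ ⋃ n ≤ N, V n` (`domainOfCover_subset_of_bound`), so `D` has finite measure for a measure finite on compacts.

SMALL COVERS EXIST for a discrete subgroup `Γ` of a Hausdorff topological group `G` acting by left multiplication: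
around every `g` there is an open `U ∋ g` with `γ U ∩ U = ∅` for `γ ≠ 1` (`exists_isOpen_smul_disjoint` — discreteness
gives an open `W ∋ 1` with `W ∩ Γ = {1}`, and `U := g U₀` with `g U₀ U₀⁻¹ g⁻¹ ⊆ W` by continuity of
`(u, u′) ↦ g u u′⁻¹ g⁻¹`); second countability turns the family into a countable cover
(`exists_fundamentalDomain_of_discrete`: a measurable strict fundamental domain for every Borel measure).  With a
compact set meeting every orbit (cocompactness) and local compactness, the domain sits inside a compact set, so it
has finite measure for a measure finite on compacts (`exists_fundamentalDomain_of_discrete_of_cocompact`); for an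
open-positive left-invariant measure every set meeting every orbit has positive measure
(`measure_pos_of_forall_exists_smul_mem`).  Together these give `0 < μ D < ⊤` for a Haar measure — the shape
`RTFData.IsHaar` asks (AdelicRTF / MixedPlaneCusp); what remains for the adelic tori `torusT W` is second
countability of `GA W` and the cocompactness of `T(k)\T(𝔸)` (a theorem of the literature, not proved here).

Nothing here says anything about the status of the Hodge conjecture for CM abelian varieties, which is NOT proved
(HC_CM is NOT proved by anyone in this repository).
-/

set_option autoImplicit false

noncomputable section

namespace Summit.Ventures.HodgeRepro.Tier4.Common

open MeasureTheory Set
open scoped Pointwise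

section Cover

variable {Γ X : Type*} [Group Γ] [MulAction Γ X]

/-- The orbit-saturation of a set: `Γ • s = ⋃ γ, γ • s`. -/
def saturate (s : Set X) : Set X := ⋃ γ : Γ, γ • s

/-- **The domain of a cover**: `D := ⋃ n, (V n ∖ ⋃ m < n, Γ • V m)`. -/
def domainOfCover (V : ℕ → Set X) : Set X :=
  ⋃ n, (V n \ ⋃ m ∈ Finset.range n, saturate (Γ := Γ) (V m))

/-- Membership in the domain of a cover. -/
theorem mem_domainOfCover {V : ℕ → Set X} {x : X} :
    x ∈ domainOfCover (Γ := Γ) V ↔ ∃ n, x ∈ V n ∧ ∀ m < n, x ∉ saturate (Γ := Γ) (V m) := by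
  simp only [domainOfCover, mem_iUnion, mem_sdiff, Finset.mem_range, exists_prop, not_exists, not_and]

/-- Membership in the saturation. -/
theorem mem_saturate {s : Set X} {x : X} : x ∈ saturate (Γ := Γ) s ↔ ∃ γ : Γ, γ • x ∈ s := by
  simp only [saturate, mem_iUnion, Set.mem_smul_set]
  constructor
  · rintro ⟨γ, y, hy, rfl⟩
    exact ⟨γ⁻¹, by simpa using hy⟩
  · rintro ⟨γ, hγ⟩
    exact ⟨γ⁻¹, γ • x, hγ, by simp⟩

/-- The saturation is `Γ`-invariant: `γ • x ∈ Γ • s ↔ x ∈ Γ • s`. -/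
theorem smul_mem_saturate_iff {s : Set X} {x : X} (γ : Γ) :
    γ • x ∈ saturate (Γ := Γ) s ↔ x ∈ saturate (Γ := Γ) s := by
  simp only [mem_saturate]
  constructor
  · rintro ⟨δ, hδ⟩
    exact ⟨δ * γ, by rwa [mul_smul]⟩
  · rintro ⟨δ, hδ⟩
    exact ⟨δ * γ⁻¹, by rwa [mul_smul, inv_smul_smul]⟩

/-- **Every orbit meets the domain of a small cover in exactly one point.** -/
theorem exists_unique_smul_mem_domainOfCover (V : ℕ → Set X) (hcover : ∀ x : X, ∃ n, x ∈ V n)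
    (hsmall : ∀ (n : ℕ) (γ : Γ), γ ≠ 1 → Disjoint (γ • V n) (V n)) (x : X) :
    ∃! γ : Γ, γ • x ∈ domainOfCover (Γ := Γ) V := by
  -- the least `n` whose `Γ`-saturation contains `x`
  have hex : ∃ n, x ∈ saturate (Γ := Γ) (V n) := by
    obtain ⟨n, hn⟩ := hcover x
    exact ⟨n, mem_saturate.mpr ⟨1, by simpa using hn⟩⟩
  classical
  let n₀ := Nat.find hex
  have hn₀ : x ∈ saturate (Γ := Γ) (V n₀) := Nat.find_spec hex
  have hmin : ∀ m < n₀, x ∉ saturate (Γ := Γ) (V m) := fun m hm => Nat.find_min hex hm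
  obtain ⟨γ₀, hγ₀⟩ := mem_saturate.mp hn₀
  refine ⟨γ₀, ?_, ?_⟩
  · show γ₀ • x ∈ domainOfCover (Γ := Γ) V
    rw [mem_domainOfCover]
    exact ⟨n₀, hγ₀, fun m hm => by rw [smul_mem_saturate_iff]; exact hmin m hm⟩
  · intro γ hγ
    change γ • x ∈ domainOfCover (Γ := Γ) V at hγ
    rw [mem_domainOfCover] at hγ
    obtain ⟨n, hn, hmin'⟩ := hγ
    -- `n = n₀`
    have hxn : x ∈ saturate (Γ := Γ) (V n) := mem_saturate.mpr ⟨γ, hn⟩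
    have hle : n₀ ≤ n := Nat.find_min' hex hxn
    have hge : n ≤ n₀ := by
      by_contra hlt
      exact hmin' n₀ (lt_of_not_ge hlt) (by rwa [smul_mem_saturate_iff])
    have hnn : n = n₀ := le_antisymm hge hle
    rw [hnn] at hn
    -- both `γ • x` and `γ₀ • x` lie in `V n`; smallness forces `γ = γ₀`
    by_contra hne
    have hδ : γ * γ₀⁻¹ ≠ 1 := by
      intro h
      apply hne
      calc γ = γ * γ₀⁻¹ * γ₀ := by group
        _ = γ₀ := by rw [h, one_mul]
    have hmem : γ • x ∈ (γ * γ₀⁻¹) • V n₀ := by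
      refine ⟨γ₀ • x, hγ₀, ?_⟩
      show (γ * γ₀⁻¹) • γ₀ • x = γ • x
      rw [mul_smul, inv_smul_smul]
    exact Set.disjoint_left.mp (hsmall n₀ (γ * γ₀⁻¹) hδ) hmem hn

/-- The domain of a cover is measurable when the cover is and the action is measurable. -/
theorem measurableSet_domainOfCover [Countable Γ] [MeasurableSpace X] (V : ℕ → Set X) (hV : ∀ n, MeasurableSet (V n))
    (hact : ∀ γ : Γ, Measurable fun x : X => γ • x) : MeasurableSet (domainOfCover (Γ := Γ) V) := by
  refine MeasurableSet.iUnion fun n => (hV n).diff (MeasurableSet.biUnion (Finset.range n).countable_toSet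
    fun m _ => ?_)
  refine MeasurableSet.iUnion fun γ => ?_
  have : γ • V m = (fun x : X => γ⁻¹ • x) ⁻¹' V m := by
    ext x
    simp only [Set.mem_smul_set, mem_preimage]
    constructor
    · rintro ⟨y, hy, rfl⟩
      simpa using hy
    · intro h
      exact ⟨γ⁻¹ • x, h, by simp⟩
  rw [this]
  exact hV m |>.preimage (hact γ⁻¹)

/-- **The domain of a small measurable cover is a fundamental domain** (Mathlib's `IsFundamentalDomain`). -/
theorem isFundamentalDomain_domainOfCover [Countable Γ] [MeasurableSpace X] (μ : Measure X) (V : ℕ → Set X)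
    (hV : ∀ n, MeasurableSet (V n)) (hact : ∀ γ : Γ, Measurable fun x : X => γ • x)
    (hcover : ∀ x : X, ∃ n, x ∈ V n) (hsmall : ∀ (n : ℕ) (γ : Γ), γ ≠ 1 → Disjoint (γ • V n) (V n)) :
    IsFundamentalDomain Γ (domainOfCover (Γ := Γ) V) μ :=
  IsFundamentalDomain.mk' (measurableSet_domainOfCover V hV hact).nullMeasurableSet
    (exists_unique_smul_mem_domainOfCover V hcover hsmall)

/-- If the first `N + 1` sets of the cover already meet every orbit, the domain lies in their union. -/
theorem domainOfCover_subset_of_bound (V : ℕ → Set X) (N : ℕ)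
    (hN : ∀ x : X, ∃ n ≤ N, x ∈ saturate (Γ := Γ) (V n)) :
    domainOfCover (Γ := Γ) V ⊆ ⋃ n ∈ Finset.range (N + 1), V n := by
  intro x hx
  rw [mem_domainOfCover] at hx
  obtain ⟨n, hn, hmin⟩ := hx
  obtain ⟨m, hmN, hm⟩ := hN x
  have : n ≤ m := by
    by_contra h
    exact hmin m (lt_of_not_ge h) hm
  simp only [mem_iUnion, Finset.mem_range, exists_prop]
  exact ⟨n, by omega, hn⟩

end Cover

section Discrete

variable {G : Type*} [Group G] [TopologicalSpace G] [IsTopologicalGroup G]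

/-- **Small neighbourhoods for a discrete subgroup**: around every `g` there is an open `U ∋ g` with
`γ • U` and `U` disjoint for every `γ ≠ 1` in the discrete subgroup `Γ` (left multiplication). -/
theorem exists_isOpen_smul_disjoint (Γ : Subgroup G) [DiscreteTopology Γ] (g : G) :
    ∃ U : Set G, IsOpen U ∧ g ∈ U ∧ ∀ γ : Γ, γ ≠ 1 → Disjoint ((γ : G) • U) U := by
  -- an open `W ∋ 1` of `G` with `W ∩ Γ = {1}`
  have h1 : IsOpen ({1} : Set Γ) := isOpen_discrete _
  rw [isOpen_induced_iff] at h1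
  obtain ⟨W, hW, hWΓ⟩ := h1
  have h1W : (1 : G) ∈ W := by
    have : (1 : Γ) ∈ (Subtype.val ⁻¹' W : Set Γ) := by rw [hWΓ]; exact rfl
    exact this
  -- continuity of `(u, u') ↦ g * u * u'⁻¹ * g⁻¹` at `(1, 1)`
  let f : G × G → G := fun p => g * p.1 * p.2⁻¹ * g⁻¹
  have hf : Continuous f := by fun_prop
  have hmem : f ⁻¹' W ∈ nhds ((1 : G), (1 : G)) := by
    apply hf.continuousAt.preimage_mem_nhds
    simpa [f] using hW.mem_nhds h1W
  rw [mem_nhds_prod_iff'] at hmem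
  obtain ⟨U₁, U₂, hU₁, h1U₁, hU₂, h1U₂, hsub⟩ := hmem
  refine ⟨g • (U₁ ∩ U₂), (hU₁.inter hU₂).smul g, ⟨1, ⟨h1U₁, h1U₂⟩, by simp⟩, ?_⟩
  intro γ hγ
  rw [Set.disjoint_left]
  rintro x ⟨y, ⟨u₂, hu₂, rfl⟩, rfl⟩ ⟨u₁, hu₁, hx⟩
  -- `γ * (g * u₂) = g * u₁` forces `γ = f (u₁, u₂) ∈ W`
  apply hγ
  have hγW : (γ : G) ∈ W := by
    have hf' : f (u₁, u₂) ∈ W := hsub ⟨hu₁.1, hu₂.2⟩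
    have : (γ : G) = f (u₁, u₂) := by
      simp only [f]
      have hx' : g * u₁ = (γ : G) * (g * u₂) := hx
      calc (γ : G) = (γ : G) * (g * u₂) * u₂⁻¹ * g⁻¹ := by group
        _ = g * u₁ * u₂⁻¹ * g⁻¹ := by rw [hx']
    rw [this]; exact hf'
  have : γ ∈ (Subtype.val ⁻¹' W : Set Γ) := hγW
  rw [hWΓ] at this
  exact this

end Discrete

section Existence

variable {G : Type*} [Group G] [TopologicalSpace G] [IsTopologicalGroup G]

omit [TopologicalSpace G] [IsTopologicalGroup G] in
/-- A small open set is still small after shrinking. -/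
theorem disjoint_smul_of_subset {Γ : Subgroup G} {U U' : Set G} (hU' : U' ⊆ U) {γ : Γ}
    (h : Disjoint ((γ : G) • U) U) : Disjoint (γ • U') U' :=
  Disjoint.mono (Set.smul_set_mono hU') hU' h

/-- **Fundamental domains exist** for a countable discrete subgroup `Γ` of a second-countable topological group
(left multiplication), for every measure on a σ-algebra containing the open sets: a measurable `D` meeting every
orbit in exactly one point.  If moreover `K` is a compact set meeting every orbit (cocompactness) and the group is
locally compact, `D` can be taken inside a compact set — in particular of finite measure for a measure that is
finite on compacts (`exists_fundamentalDomain_of_discrete_of_cocompact`). -/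
theorem exists_fundamentalDomain_of_discrete [SecondCountableTopology G] [MeasurableSpace G]
    [BorelSpace G] (Γ : Subgroup G) [DiscreteTopology Γ] [Countable Γ] (μ : Measure G) :
    ∃ D : Set G, MeasurableSet D ∧ IsFundamentalDomain Γ D μ ∧ ∀ x : G, ∃! γ : Γ, γ • x ∈ D := by
  choose U hU hgU hsmall using exists_isOpen_smul_disjoint Γ
  obtain ⟨T, hTc, hTU⟩ := TopologicalSpace.isOpen_iUnion_countable U hU
  have hTne : T.Nonempty := by
    by_contra h
    rw [Set.not_nonempty_iff_eq_empty] at h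
    have : (1 : G) ∈ ⋃ i ∈ T, U i := by rw [hTU]; exact Set.mem_iUnion.mpr ⟨1, hgU 1⟩
    simp [h] at this
  obtain ⟨e, hT⟩ := hTc.exists_eq_range hTne
  let V : ℕ → Set G := fun n => U (e n)
  have hcover : ∀ x : G, ∃ n, x ∈ V n := by
    intro x
    have : x ∈ ⋃ i ∈ T, U i := by rw [hTU]; exact Set.mem_iUnion.mpr ⟨x, hgU x⟩
    rw [hT] at this
    simp only [Set.mem_iUnion, Set.mem_range, exists_prop, exists_exists_eq_and] at this
    exact this
  have hsmall' : ∀ (n : ℕ) (γ : Γ), γ ≠ 1 → Disjoint (γ • V n) (V n) := fun n γ hγ =>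
    hsmall (e n) γ hγ
  have hV : ∀ n, MeasurableSet (V n) := fun n => (hU (e n)).measurableSet
  have hact : ∀ γ : Γ, Measurable fun x : G => γ • x := fun γ => (continuous_const_smul γ).measurable
  exact ⟨domainOfCover (Γ := Γ) V, measurableSet_domainOfCover V hV hact,
    isFundamentalDomain_domainOfCover μ V hV hact hcover hsmall',
    exists_unique_smul_mem_domainOfCover V hcover hsmall'⟩

/-- **Cocompact case**: a countable discrete subgroup `Γ` of a locally compact second-countable group with a
compact `K` meeting every orbit has a measurable fundamental domain contained in a compact set, hence of finite
measure for every measure finite on compacts. -/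
theorem exists_fundamentalDomain_of_discrete_of_cocompact [LocallyCompactSpace G] [SecondCountableTopology G]
    [MeasurableSpace G] [BorelSpace G] (Γ : Subgroup G) [DiscreteTopology Γ] [Countable Γ]
    (μ : Measure G) [IsFiniteMeasureOnCompacts μ] (K : Set G) (hK : IsCompact K)
    (hKΓ : ∀ x : G, ∃ γ : Γ, γ • x ∈ K) :
    ∃ D : Set G, MeasurableSet D ∧ IsFundamentalDomain Γ D μ ∧ (∀ x : G, ∃! γ : Γ, γ • x ∈ D) ∧
      (∃ L : Set G, IsCompact L ∧ D ⊆ L) ∧ μ D < ⊤ := by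
  -- small open neighbourhoods inside compact neighbourhoods
  have hUex : ∀ g : G, ∃ U : Set G, IsOpen U ∧ g ∈ U ∧ (∃ L : Set G, IsCompact L ∧ U ⊆ L) ∧
      ∀ γ : Γ, γ ≠ 1 → Disjoint ((γ : G) • U) U := by
    intro g
    obtain ⟨U, hU, hgU, hsmall⟩ := exists_isOpen_smul_disjoint Γ g
    obtain ⟨L, hL, hLg⟩ := exists_compact_mem_nhds g
    refine ⟨U ∩ interior L, hU.inter isOpen_interior, ⟨hgU, mem_interior_iff_mem_nhds.mpr hLg⟩,
      ⟨L, hL, Set.inter_subset_right.trans interior_subset⟩, fun γ hγ => ?_⟩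
    exact disjoint_smul_of_subset Set.inter_subset_left (hsmall γ hγ)
  choose U hU hgU hUL hsmall using hUex
  obtain ⟨T, hTc, hTU⟩ := TopologicalSpace.isOpen_iUnion_countable U hU
  have hTne : T.Nonempty := by
    by_contra h
    rw [Set.not_nonempty_iff_eq_empty] at h
    have : (1 : G) ∈ ⋃ i ∈ T, U i := by rw [hTU]; exact Set.mem_iUnion.mpr ⟨1, hgU 1⟩
    simp [h] at this
  obtain ⟨e, hT⟩ := hTc.exists_eq_range hTne
  let V : ℕ → Set G := fun n => U (e n)
  have hcover : ∀ x : G, ∃ n, x ∈ V n := by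
    intro x
    have : x ∈ ⋃ i ∈ T, U i := by rw [hTU]; exact Set.mem_iUnion.mpr ⟨x, hgU x⟩
    rw [hT] at this
    simp only [Set.mem_iUnion, Set.mem_range, exists_prop, exists_exists_eq_and] at this
    exact this
  have hsmall' : ∀ (n : ℕ) (γ : Γ), γ ≠ 1 → Disjoint (γ • V n) (V n) := fun n γ hγ =>
    hsmall (e n) γ hγ
  have hV : ∀ n, MeasurableSet (V n) := fun n => (hU (e n)).measurableSet
  have hact : ∀ γ : Γ, Measurable fun x : G => γ • x := fun γ => (continuous_const_smul γ).measurable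
  -- finitely many `V n` cover `K`
  have hKsub : K ⊆ ⋃ n, V n := fun x _ => Set.mem_iUnion.mpr (hcover x)
  obtain ⟨t, ht⟩ := hK.elim_finite_subcover V (fun n => hU (e n)) hKsub
  let N : ℕ := t.sup id
  have hN : ∀ x : G, ∃ n ≤ N, x ∈ saturate (Γ := Γ) (V n) := by
    intro x
    obtain ⟨γ, hγ⟩ := hKΓ x
    have := ht hγ
    simp only [Set.mem_iUnion, exists_prop] at this
    obtain ⟨n, hnt, hn⟩ := this
    exact ⟨n, Finset.le_sup (f := id) hnt, mem_saturate.mpr ⟨γ, hn⟩⟩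
  have hsub : domainOfCover (Γ := Γ) V ⊆ ⋃ n ∈ Finset.range (N + 1), V n :=
    domainOfCover_subset_of_bound V N hN
  -- the compact set `L := ⋃ n ≤ N, L n`
  choose L hL hUL' using fun n : ℕ => hUL (e n)
  have hLc : IsCompact (⋃ n ∈ Finset.range (N + 1), L n) :=
    (Finset.range (N + 1)).isCompact_biUnion fun n _ => hL n
  have hDL : domainOfCover (Γ := Γ) V ⊆ ⋃ n ∈ Finset.range (N + 1), L n :=
    hsub.trans (Set.iUnion₂_mono fun n _ => hUL' n)
  refine ⟨domainOfCover (Γ := Γ) V, measurableSet_domainOfCover V hV hact,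
    isFundamentalDomain_domainOfCover μ V hV hact hcover hsmall',
    exists_unique_smul_mem_domainOfCover V hcover hsmall', ⟨_, hLc, hDL⟩, ?_⟩
  exact lt_of_le_of_lt (measure_mono hDL) hLc.measure_lt_top

/-- A fundamental domain meeting every orbit has positive measure for an open-positive left-invariant measure. -/
theorem measure_pos_of_forall_exists_smul_mem [MeasurableSpace G] [BorelSpace G] (Γ : Subgroup G) [Countable Γ]
    (μ : Measure G) [μ.IsOpenPosMeasure] [μ.IsMulLeftInvariant] (D : Set G)
    (hD : ∀ x : G, ∃ γ : Γ, γ • x ∈ D) : 0 < μ D := by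
  rw [pos_iff_ne_zero]
  intro h0
  have hcov : (Set.univ : Set G) ⊆ ⋃ γ : Γ, (fun x : G => (γ : G) * x) ⁻¹' D := by
    intro x _
    obtain ⟨γ, hγ⟩ := hD x
    exact Set.mem_iUnion.mpr ⟨γ, hγ⟩
  have hle : μ (Set.univ : Set G) ≤ ∑' γ : Γ, μ ((fun x : G => (γ : G) * x) ⁻¹' D) :=
    (measure_mono hcov).trans (measure_iUnion_le _)
  have hzero : ∀ γ : Γ, μ ((fun x : G => (γ : G) * x) ⁻¹' D) = 0 := fun γ => by
    rw [measure_preimage_mul μ (γ : G) D]; exact h0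
  simp only [hzero, tsum_zero, nonpos_iff_eq_zero] at hle
  exact (isOpen_univ.measure_pos μ Set.univ_nonempty).ne' hle

end Existence

end Summit.Ventures.HodgeRepro.Tier4.Common

end
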